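import Literature.Analysis.FluidPDE.TorusVorticityTensorTransport
import Literature.Analysis.FluidPDE.ExtremeGrowthVorticityControlProofs
import HarnessLib

/-!
# Miller's strain–vorticity orthogonality `⟨−ΔS, ω ⊗ ω⟩ = 0` on the flat torus

Analysis/FluidPDE proof file (theorems only: no definitions, no named facts).
Search for candidate a priori estimates; no regularity claim.

E. Miller, *On the interaction of strain and vorticity for solutions of the Navier–Stokes
equation*, Pure Appl. Anal. 8 (2026) 247–270 = arXiv:2407.02691, **Theorem 1.3 (= Theorem 3.1)**:
"Suppose `S ∈ H²_{st}`, with `S = ∇_{sym}u` and `ω = ∇ × u`. Then `⟨−ΔS, ω ⊗ ω⟩ = 0`." Printed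
proof (§3): `⟨−ΔS, ω⊗ω⟩ = ⟨∇(−Δu), ω⊗ω⟩ = −⟨−Δu, (ω·∇)ω⟩` (symmetry of `ω⊗ω`, integration by
parts, `∇·ω = 0`), then `(ω·∇)ω = (∇×ω)×ω + ∇½|ω|²` with `∇×ω = −Δu`, and
`⟨−Δu, −Δu × ω⟩ = 0` pointwise, `⟨−Δu, ∇½|ω|²⟩ = 0` because `∇·(−Δu) = 0`.

Here, for SMOOTH divergence-free fields `v` on the flat unit torus `T^d = UnitAddTorus d`
(the setting of the functional-mining census; Miller, PAA 2026, works on `ℝ³`, and states for the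
companion results of [Miller2019], p. 6, that they "apply equally on the torus"), in the tree's
orientation-free vocabulary (`torusVorticityTensor v i j = (∂ᵢv)ⱼ − (∂ⱼv)ᵢ =: Wᵢⱼ`,
`torusVorticitySqAt v = ½∑ᵢⱼWᵢⱼ² = |ω|²`):

* `StrainVorticityOrthogonality.integral_sum_partialDeriv_laplacian_mul_vorticityTensor_sq_eq_zero`
  — the identity in EVERY dimension, tensor form: `∫ ∑ᵢⱼ (∂ᵢΔv)ⱼ (W²)ᵢⱼ = 0`,
  `(W²)ᵢⱼ = ∑ₖ WᵢₖWₖⱼ`. The printed proof transcribes index-by-index: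
  `∑ᵢ ∂ᵢWᵢₖ = (Δv)ₖ` (`∇×ω = −Δu`), `∑ⱼₖ (Δv)ⱼ(Δv)ₖWₖⱼ = 0` (`Δu ⊥ Δu × ω` pointwise),
  `∑ᵢₖ Wᵢₖ ∂ᵢWₖⱼ = −½ ∂ⱼ|ω|²` (the `∇½|ω|²` part of `(ω·∇)ω`), `∫ ⟪Δv, ∇|ω|²⟫ = 0` (`div Δv = 0`).
* `integral_sum_laplacian_strain_mul_vorticityTensor_sq_eq_zero` — the same with the
  symmetrised factor `(ΔS)ᵢⱼ = ½((∂ᵢΔv)ⱼ + (∂ⱼΔv)ᵢ)` (`= Δ` of `Sᵢⱼ = ½((∂ᵢv)ⱼ + (∂ⱼv)ᵢ)`,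
  `laplacian_strain_apply`).
* `integral_sum_vorticity_laplacianStrain_vorticity_eq_zero` — **Theorem 1.3 as printed on `T³`**
  (`card d = 3`, any labelling `e : d ≃ Fin 3`, `ωₐ := W_{e⁻¹(e a+1), e⁻¹(e a+2)}` the curl read in
  the frame `e`): `∫ ∑ₐᵦ ωₐ (ΔS)ₐᵦ ω_b = 0`, from the tensor form through the pointwise identity
  `ωₐω_b = (W²)ₐᵦ + |ω|² δₐᵦ` and `tr ΔS = div Δv = 0`.
* `integral_inner_convect_laplacian_eq_integral_torusStretchingDensity` — the folklore bridge
  `∫ ⟪(v·∇)v, Δv⟫ = ∫ σ` (`σ = torusStretchingDensity v = tr(S W²)`; in `d = 3`, `σ = ωᵀSω`), i.e.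
  the inertial term of the enstrophy balance `dℰ/dt = −ν‖Δu‖₂² + ∫⟪(u·∇)u, Δu⟫` IS the
  stretching integral `⟨S, ω⊗ω⟩` (Miller, PAA 2026, (6.3): `d/dt ½‖ω‖² = −‖ω‖²_{Ḣ¹} + ⟨S, ω⊗ω⟩`);
  pointwise `σ = tr(∇v)³ − tr(∇v ∇vᵀ ∇vᵀ)` in every dimension, Betchov's `∫tr(∇v)³ = 0`
  (`integral_sum_partialDeriv_cube_eq_zero`) and `Torus.integral_inner_laplacian_convect_self_eq_neg`.
* `integral_torusStretchingDensity_eq_integral_shifted` /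
  `integral_sum_vorticity_strain_vorticity_eq_shifted` — the form in which Theorem 1.3 enters the
  proof of Miller's Theorem 1.12 ((6.5): "for all `ρ ∈ ℝ`,
  `d/dt ½‖ω‖² = −‖ω‖²_{Ḣ¹} − ⟨−ρΔS − S, ω⊗ω⟩`"): for every `ρ`,
  `∫ σ = ∫ ∑ᵢⱼ (Sᵢⱼ + ρ(ΔS)ᵢⱼ)(W²)ᵢⱼ` (any `d`) and, on `T³`, `∫ ωᵀSω = ∫ ωᵀ(S + ρΔS)ω`.

These serve the functional-mining cell (pub-nsfunc): a new EXACT static identity for the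
dictionary (the functional `v ↦ ∫ ωᵀ(ΔS)ω` vanishes identically on divergence-free fields, in every
dimension in the tensor form), the analytic input of CRITERIA row A20 (Miller's "strain almost an
eigenfunction of the Laplacian" criterion, sequel file `TorusNSStrainAlmostEigenCriterion`), and the
TAO-BARRIER §3 note that the `ω⊗ω`-interaction term of the strain equation is neutral for BOTH
`‖S‖₂²` and `‖∇S‖₂²` (Miller, PAA 2026, Prop. 5.1).

## Mathlib / tree search

Tree (used): `torusVorticityTensor`, `torusStretchingDensity`, `torusVorticitySqAt_eq_sum_sq_of_equiv`,
`torusStretchingDensity_eq_sum_strain_of_equiv_of_isDivFree` (`TorusVorticityTensorTransport`);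
`integral_sum_partialDeriv_cube_eq_zero` (Betchov), `DoeringGibbon1995.torus_partialDeriv_const`
(`ExtremeGrowthVorticityControlProofs`); `Torus.integral_inner_laplacian_convect_self_eq_neg`,
`Torus.partialDeriv_comm`, `Torus.partialDeriv_apply_coord`, `Torus.partialDeriv_finset_sum`,
`Torus.divergence_eq_sum_partialDeriv_apply` (`TorusEnstrophyOrthogonality`);
`Torus.IsDivFree.laplacian_of_isSmooth` (`TorusClassicalH1Balance`); `Torus.partialDeriv_laplacian_comm`,
`Torus.laplacian_clm_comp_apply`, `Torus.laplacian_eq_sum_partialDeriv_partialDeriv`,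
`Torus.integral_fderiv_apply_eq_zero_of_isDivFree`, `Torus.fderiv_apply_eq_sum_partialDeriv`,
`Torus.partialDeriv_mul/_add/_neg/_smul`, `Torus.integral_partialDeriv_eq_zero_holds`.
Searched (`lean search`): `Miller202[4-6]|strainVorticity|laplacian.*[Ss]train.*vorticity|2407.02691`
— nothing in the tree; the identity is new to it.

## References

* [Miller2026StrainVorticity] E. Miller, *On the interaction of strain and vorticity for solutions
  of the Navier–Stokes equation*, Pure Appl. Anal. 8 (2026), no. 1, 247–270,
  doi:10.2140/paa.2026.8.247 = arXiv:2407.02691; Thm 1.3 / Thm 3.1 with proof (held text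
  paper:arxiv-2407.02691, chunks 4 and 10), eq. (6.3)–(6.5) (chunk 15).
* [Miller2023StrainModel] E. Miller, Anal. PDE 16 (2023) 997–1032, Prop. 1.9
  (`⟨S, ω⊗ω⟩ = −4∫det S`; tree `TorusEnstrophyStrainIdentity`).
* [MajdaBertozziCUP2002] §1.4 (1.21), (1.31)–(1.32) (the frame reading `ωₐ = W_{a+1,a+2}`).
-/

noncomputable section

open Set MeasureTheory Finset
open scoped ContDiff InnerProductSpace RealInnerProductSpace

namespace Literature.Analysis.FluidPDE

open Literature.Analysis.FunctionSpaces

variable {d : Type*} [Fintype d] [DecidableEq d]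

namespace StrainVorticityOrthogonality

/-! ### Pointwise algebra -/

omit [DecidableEq d] in
/-- `∑ⱼₖ aⱼ aₖ Wₖⱼ = 0` for an antisymmetric array `W` ("`−Δu × ω` is orthogonal to `−Δu`
point-wise", Miller, PAA 2026, proof of Thm 3.1). [folklore] -/
private theorem sum_mul_mul_antisymm_eq_zero (a : d → ℝ) (W : d → d → ℝ) (hW : ∀ i j, W j i = -W i j) :
    ∑ j, ∑ k, a j * a k * W k j = 0 := by
  have h : ∑ j, ∑ k, a j * a k * W k j = ∑ j, ∑ k, -(a j * a k * W k j) := by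
    conv_lhs => rw [Finset.sum_comm]
    refine Finset.sum_congr rfl fun j _ => Finset.sum_congr rfl fun k _ => ?_
    rw [hW k j]; ring
  simp only [Finset.sum_neg_distrib] at h
  linarith

omit [DecidableEq d] in
/-- `∑ᵢₖ Wᵢₖ Hᵢₖ = 0` for `W` antisymmetric and `H` symmetric. [folklore] -/
private theorem sum_antisymm_mul_symm_eq_zero (W H : d → d → ℝ) (hW : ∀ i j, W j i = -W i j)
    (hH : ∀ i j, H j i = H i j) : ∑ i, ∑ k, W i k * H i k = 0 := by
  have h : ∑ i, ∑ k, W i k * H i k = ∑ i, ∑ k, -(W i k * H i k) := by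
    conv_lhs => rw [Finset.sum_comm]
    refine Finset.sum_congr rfl fun i _ => Finset.sum_congr rfl fun k _ => ?_
    rw [hW i k, hH i k]; ring
  simp only [Finset.sum_neg_distrib] at h
  linarith

/-- `(W²)ᵢⱼ = ∑ₖ WᵢₖWₖⱼ` is symmetric for antisymmetric `W`. [folklore] -/
private theorem sum_vorticityTensor_mul_comm (v : UnitAddTorus d → EuclideanSpace ℝ d) (i j : d)
    (x : UnitAddTorus d) :
    ∑ k, torusVorticityTensor v j k x * torusVorticityTensor v k i x =
      ∑ k, torusVorticityTensor v i k x * torusVorticityTensor v k j x := by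
  refine Finset.sum_congr rfl fun k _ => ?_
  rw [torusVorticityTensor_swap v j k, torusVorticityTensor_swap v k i]
  ring

/-! ### Calculus of the vorticity tensor -/

/-- `Wᵢⱼ` of a smooth field is smooth. [folklore] -/
private theorem isSmooth_vorticityTensor {v : UnitAddTorus d → EuclideanSpace ℝ d}
    (hv : Torus.IsSmooth v) (i j : d) : Torus.IsSmooth (torusVorticityTensor v i j) :=
  ((hv.partialDeriv i).apply j).sub ((hv.partialDeriv j).apply i)

/-- `∂ₖWᵢⱼ = (∂ₖ∂ᵢv)ⱼ − (∂ₖ∂ⱼv)ᵢ` for smooth `v`. [folklore] -/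
private theorem partialDeriv_vorticityTensor {v : UnitAddTorus d → EuclideanSpace ℝ d}
    (hv : Torus.IsSmooth v) (i j k : d) (x : UnitAddTorus d) :
    Torus.partialDeriv k (torusVorticityTensor v i j) x =
      Torus.partialDeriv k (Torus.partialDeriv i v) x j -
        Torus.partialDeriv k (Torus.partialDeriv j v) x i := by
  have hi : Torus.IsContDiff 1 (fun y => Torus.partialDeriv i v y j) :=
    ((hv.partialDeriv i).apply j).isContDiff (by simp)
  have hj : Torus.IsContDiff 1 (fun y => -Torus.partialDeriv j v y i) :=
    ((hv.partialDeriv j).apply i).neg.isContDiff (by simp)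
  have hfun : torusVorticityTensor v i j =
      (fun y => Torus.partialDeriv i v y j) + fun y => -Torus.partialDeriv j v y i := by
    funext y; simp [torusVorticityTensor, sub_eq_add_neg]
  rw [hfun, Torus.partialDeriv_add hi hj k, Pi.add_apply, Torus.partialDeriv_neg,
    Torus.partialDeriv_apply_coord ((hv.partialDeriv i).isContDiff (by simp)),
    Torus.partialDeriv_apply_coord ((hv.partialDeriv j).isContDiff (by simp))]
  ring

/-- The `k`-th component of the Laplacian is the sum of pure second derivatives of the `k`-th
component: `(Δv)ₖ(x) = ∑ᵢ (∂ᵢ∂ᵢv)ₖ(x)`. [folklore] -/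
private theorem laplacian_apply_eq_sum {v : UnitAddTorus d → EuclideanSpace ℝ d} (hv : Torus.IsSmooth v)
    (k : d) (x : UnitAddTorus d) :
    Torus.laplacian v x k = ∑ i, Torus.partialDeriv i (Torus.partialDeriv i v) x k := by
  have hvk : Torus.IsSmooth (fun y => v y k) := hv.apply k
  have e1 : Torus.laplacian v x k = Torus.laplacian (fun y => v y k) x := by
    have := Torus.laplacian_clm_comp_apply hv (EuclideanSpace.proj k : EuclideanSpace ℝ d →L[ℝ] ℝ) x
    simpa [Function.comp_def] using this.symm
  rw [e1, Torus.laplacian_eq_sum_partialDeriv_partialDeriv hvk]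
  refine Finset.sum_congr rfl fun i _ => ?_
  have e2 : Torus.partialDeriv i (fun y => v y k) = fun y => Torus.partialDeriv i v y k := by
    funext y; exact Torus.partialDeriv_apply_coord (hv.isContDiff (by simp)) _ y _
  rw [e2, Torus.partialDeriv_apply_coord ((hv.partialDeriv i).isContDiff (by simp))]

/-- **`∑ᵢ ∂ᵢWᵢₖ = (Δv)ₖ` for smooth divergence-free `v`** (`div` of the antisymmetric part of the
gradient: `∑ᵢ ∂ᵢ∂ᵢvₖ − ∂ₖ div v`; the tensor reading of `∇ × ω = −Δu`, Miller, PAA 2026, proof of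
Thm 3.1). [cite: Miller2026StrainVorticity, §3, proof of Thm 3.1] -/
theorem sum_partialDeriv_vorticityTensor_eq_laplacian {v : UnitAddTorus d → EuclideanSpace ℝ d}
    (hv : Torus.IsSmooth v) (hdiv : Torus.IsDivFree v) (k : d) (x : UnitAddTorus d) :
    ∑ i, Torus.partialDeriv i (torusVorticityTensor v i k) x = Torus.laplacian v x k := by
  have hv1 : Torus.IsContDiff 1 v := hv.isContDiff (by simp)
  have hD1 : ∀ m, Torus.IsContDiff 1 (Torus.partialDeriv m v) := fun m =>
    (hv.partialDeriv m).isContDiff (by simp)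
  have hDc1 : ∀ m j, Torus.IsContDiff 1 (fun y => Torus.partialDeriv m v y j) := fun m j =>
    ((hv.partialDeriv m).apply j).isContDiff (by simp)
  have hcomm : ∀ j m l y, Torus.partialDeriv j (fun z => Torus.partialDeriv m v z l) y =
      Torus.partialDeriv m (fun z => Torus.partialDeriv j v z l) y := by
    intro j m l y
    rw [Torus.partialDeriv_apply_coord (hD1 m), Torus.partialDeriv_apply_coord (hD1 j),
      Torus.partialDeriv_comm hv j m y]
  simp_rw [partialDeriv_vorticityTensor hv]
  rw [Finset.sum_sub_distrib, laplacian_apply_eq_sum hv k x]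
  -- `∑ᵢ (∂ᵢ∂ₖv)ᵢ = ∂ₖ div v = 0`
  have hvan : ∑ i, Torus.partialDeriv i (Torus.partialDeriv k v) x i = 0 := by
    have h1 : ∀ i, Torus.partialDeriv i (Torus.partialDeriv k v) x i =
        Torus.partialDeriv k (fun z => Torus.partialDeriv i v z i) x := by
      intro i
      rw [← Torus.partialDeriv_apply_coord (hD1 k), hcomm i k i x]
    simp_rw [h1]
    rw [← Torus.partialDeriv_finset_sum Finset.univ (fun i _ => hDc1 i i)]
    have hdivfun : (fun y => ∑ i, Torus.partialDeriv i v y i) = fun _ => (0 : ℝ) := by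
      funext y
      rw [← Torus.divergence_eq_sum_partialDeriv_apply hv1]
      exact hdiv y
    rw [hdivfun, DoeringGibbon1995.torus_partialDeriv_const]
  rw [hvan, sub_zero]

/-- `∂ₖ|ω|² = ∑ᵢⱼ Wᵢⱼ ∂ₖWᵢⱼ` for smooth `v`. [folklore] -/
private theorem partialDeriv_torusVorticitySqAt_eq {v : UnitAddTorus d → EuclideanSpace ℝ d}
    (hv : Torus.IsSmooth v) (k : d) (x : UnitAddTorus d) :
    Torus.partialDeriv k (torusVorticitySqAt v) x =
      ∑ i, ∑ j, torusVorticityTensor v i j x * Torus.partialDeriv k (torusVorticityTensor v i j) x := by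
  have hW1 : ∀ i j, Torus.IsContDiff 1 (torusVorticityTensor v i j) :=
    fun i j => (isSmooth_vorticityTensor hv i j).isContDiff (by simp)
  have hsq : ∀ i j, Torus.IsContDiff 1
      (fun y => torusVorticityTensor v i j y * torusVorticityTensor v i j y) :=
    fun i j => (hW1 i j).mul (hW1 i j)
  have hrow : ∀ i, Torus.IsContDiff 1
      (fun y => ∑ j, torusVorticityTensor v i j y * torusVorticityTensor v i j y) := by
    intro i
    have h : Torus.lift (fun y => ∑ j, torusVorticityTensor v i j y * torusVorticityTensor v i j y) =
        fun z => ∑ j, Torus.lift (fun y => torusVorticityTensor v i j y * torusVorticityTensor v i j y) z := rfl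
    unfold Torus.IsContDiff
    rw [h]
    exact ContDiff.sum fun j _ => hsq i j
  have hfun : torusVorticitySqAt v = fun y => (2⁻¹ : ℝ) •
      ∑ i, ∑ j, torusVorticityTensor v i j y * torusVorticityTensor v i j y := by
    funext y
    rw [show torusVorticitySqAt v y = 2⁻¹ * ∑ i, ∑ j, torusVorticityTensor v i j y ^ 2 from rfl,
      smul_eq_mul]
    congr 1
    exact Finset.sum_congr rfl fun i _ => Finset.sum_congr rfl fun j _ => by ring
  rw [hfun, Torus.partialDeriv_smul (Torus.isContDiff_const _) ?_ k x]
  swap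
  · have h : Torus.lift (fun y => ∑ i, ∑ j, torusVorticityTensor v i j y * torusVorticityTensor v i j y) =
        fun z => ∑ i, Torus.lift (fun y => ∑ j, torusVorticityTensor v i j y * torusVorticityTensor v i j y) z := rfl
    unfold Torus.IsContDiff
    rw [h]
    exact ContDiff.sum fun i _ => hrow i
  have hc : Torus.partialDeriv k (fun _ : UnitAddTorus d => (2⁻¹ : ℝ)) x = 0 := by
    simp [Torus.partialDeriv, Torus.lineDeriv]
  rw [hc, zero_smul, add_zero, Torus.partialDeriv_finset_sum _ (fun i _ => hrow i), smul_eq_mul,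
    Finset.mul_sum]
  refine Finset.sum_congr rfl fun i _ => ?_
  rw [Torus.partialDeriv_finset_sum _ (fun j _ => hsq i j), Finset.mul_sum]
  refine Finset.sum_congr rfl fun j _ => ?_
  rw [Torus.partialDeriv_mul (hW1 i j) (hW1 i j)]
  ring

/-- **`∑ᵢₖ Wᵢₖ ∂ᵢWₖⱼ = −½ ∂ⱼ|ω|²` for smooth `v`** (the tensor reading of the gradient part of
`(ω·∇)ω = (∇×ω)×ω + ∇½|ω|²`: the `(∂ᵢ∂ₖv)ⱼ` part drops by antisymmetry, the `(∂ᵢ∂ⱼv)ₖ` part is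
`½∂ⱼ` of `|ω|² = ½∑Wᵢₖ²`; Miller, PAA 2026, proof of Thm 3.1). [cite: Miller2026StrainVorticity, §3, proof of Thm 3.1] -/
theorem sum_vorticityTensor_mul_partialDeriv_eq {v : UnitAddTorus d → EuclideanSpace ℝ d}
    (hv : Torus.IsSmooth v) (j : d) (x : UnitAddTorus d) :
    ∑ i, ∑ k, torusVorticityTensor v i k x * Torus.partialDeriv i (torusVorticityTensor v k j) x =
      -(2⁻¹ * Torus.partialDeriv j (torusVorticitySqAt v) x) := by
  -- second derivatives `H a b c = (∂ₐ∂_b v)_c`, symmetric in `a, b`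
  set H : d → d → d → ℝ := fun a b c => Torus.partialDeriv a (Torus.partialDeriv b v) x c with hH
  have hsym : ∀ a b c, H a b c = H b a c := fun a b c => by
    simp only [hH]; rw [Torus.partialDeriv_comm hv a b x]
  have hWs : ∀ i k, torusVorticityTensor v k i x = -torusVorticityTensor v i k x :=
    fun i k => torusVorticityTensor_swap v i k x
  -- the left side: `∑ᵢₖ Wᵢₖ (H i k j − H i j k) = −∑ᵢₖ Wᵢₖ H j i k`
  have hL : ∑ i, ∑ k, torusVorticityTensor v i k x *
      Torus.partialDeriv i (torusVorticityTensor v k j) x =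
      -∑ i, ∑ k, torusVorticityTensor v i k x * H j i k := by
    have h1 : ∀ i k, Torus.partialDeriv i (torusVorticityTensor v k j) x = H i k j - H i j k := by
      intro i k; rw [partialDeriv_vorticityTensor hv]
    simp_rw [h1, mul_sub, Finset.sum_sub_distrib]
    have h2 : ∑ i, ∑ k, torusVorticityTensor v i k x * H i k j = 0 :=
      sum_antisymm_mul_symm_eq_zero (fun i k => torusVorticityTensor v i k x) (fun i k => H i k j)
        hWs (fun i k => hsym k i j)
    have h3 : ∑ i, ∑ k, torusVorticityTensor v i k x * H i j k =
        ∑ i, ∑ k, torusVorticityTensor v i k x * H j i k :=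
      Finset.sum_congr rfl fun i _ => Finset.sum_congr rfl fun k _ => by rw [hsym i j k]
    rw [h2, h3, zero_sub]
  -- the right side: `∂ⱼ|ω|² = ∑ᵢₖ Wᵢₖ (H j i k − H j k i) = 2 ∑ᵢₖ Wᵢₖ H j i k`
  have hR : Torus.partialDeriv j (torusVorticitySqAt v) x =
      2 * ∑ i, ∑ k, torusVorticityTensor v i k x * H j i k := by
    rw [partialDeriv_torusVorticitySqAt_eq hv]
    have h1 : ∀ i k, Torus.partialDeriv j (torusVorticityTensor v i k) x = H j i k - H j k i := by
      intro i k; rw [partialDeriv_vorticityTensor hv]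
    simp_rw [h1, mul_sub, Finset.sum_sub_distrib]
    have h4 : ∑ i, ∑ k, torusVorticityTensor v i k x * H j k i =
        -∑ i, ∑ k, torusVorticityTensor v i k x * H j i k := by
      rw [Finset.sum_comm]
      simp only [← Finset.sum_neg_distrib]
      refine Finset.sum_congr rfl fun i _ => Finset.sum_congr rfl fun k _ => ?_
      rw [hWs i k]; ring
    rw [h4]; ring
  rw [hL, hR]; ring

/-! ### Smoothness bookkeeping -/

/-- `(W²)ᵢⱼ = ∑ₖ WᵢₖWₖⱼ` is smooth. [folklore] -/
private theorem isSmooth_vorticityTensor_sq {v : UnitAddTorus d → EuclideanSpace ℝ d}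
    (hv : Torus.IsSmooth v) (i j : d) :
    Torus.IsSmooth (fun y => ∑ k, torusVorticityTensor v i k y * torusVorticityTensor v k j y) := by
  have h : ∀ k, Torus.IsSmooth (fun y => torusVorticityTensor v i k y * torusVorticityTensor v k j y) :=
    fun k => (isSmooth_vorticityTensor hv i k).mul (isSmooth_vorticityTensor hv k j)
  have hl : Torus.lift (fun y => ∑ k, torusVorticityTensor v i k y * torusVorticityTensor v k j y) =
      fun z => ∑ k, Torus.lift (fun y => torusVorticityTensor v i k y * torusVorticityTensor v k j y) z := rfl
  unfold Torus.IsSmooth at h ⊢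
  rw [hl]
  exact ContDiff.sum fun k _ => h k

/-- `|ω|²` of a smooth field is smooth. [folklore] -/
private theorem isSmooth_torusVorticitySqAt {v : UnitAddTorus d → EuclideanSpace ℝ d}
    (hv : Torus.IsSmooth v) : Torus.IsSmooth (torusVorticitySqAt v) := by
  have h : ∀ i j, Torus.IsSmooth (fun y => torusVorticityTensor v i j y ^ 2) := fun i j => by
    have := isSmooth_vorticityTensor hv i j
    exact this.pow 2
  have hl : Torus.lift (torusVorticitySqAt v) =
      fun z => (2⁻¹ : ℝ) * ∑ i, ∑ j, Torus.lift (fun y => torusVorticityTensor v i j y ^ 2) z := by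
    funext z; rfl
  unfold Torus.IsSmooth at h ⊢
  rw [hl]
  exact contDiff_const.mul (ContDiff.sum fun i _ => ContDiff.sum fun j _ => h i j)

/-! ### The identity, tensor form, every dimension -/

/-- **`∑ᵢ ∂ᵢ(W²)ᵢⱼ = ∑ₖ (Δv)ₖ Wₖⱼ − ½∂ⱼ|ω|²`** for smooth divergence-free `v`
(`div(ω⊗ω) = (ω·∇)ω = (∇×ω)×ω + ∇½|ω|²` with `∇×ω = −Δu`, read on the tensor `W²`;
Miller, PAA 2026, proof of Thm 3.1). [cite: Miller2026StrainVorticity, §3, proof of Thm 3.1] -/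
theorem sum_partialDeriv_vorticityTensor_sq {v : UnitAddTorus d → EuclideanSpace ℝ d}
    (hv : Torus.IsSmooth v) (hdiv : Torus.IsDivFree v) (j : d) (x : UnitAddTorus d) :
    ∑ i, Torus.partialDeriv i
        (fun y => ∑ k, torusVorticityTensor v i k y * torusVorticityTensor v k j y) x =
      (∑ k, Torus.laplacian v x k * torusVorticityTensor v k j x) -
        2⁻¹ * Torus.partialDeriv j (torusVorticitySqAt v) x := by
  have hW1 : ∀ a b, Torus.IsContDiff 1 (torusVorticityTensor v a b) :=
    fun a b => (isSmooth_vorticityTensor hv a b).isContDiff (by simp)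
  have hmul : ∀ i k, Torus.IsContDiff 1
      (fun y => torusVorticityTensor v i k y * torusVorticityTensor v k j y) :=
    fun i k => (hW1 i k).mul (hW1 k j)
  have hprod : ∀ i, Torus.partialDeriv i
      (fun y => ∑ k, torusVorticityTensor v i k y * torusVorticityTensor v k j y) x =
      ∑ k, (Torus.partialDeriv i (torusVorticityTensor v i k) x * torusVorticityTensor v k j x +
        torusVorticityTensor v i k x * Torus.partialDeriv i (torusVorticityTensor v k j) x) := by
    intro i
    rw [Torus.partialDeriv_finset_sum Finset.univ (fun k _ => hmul i k)]
    refine Finset.sum_congr rfl fun k _ => ?_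
    rw [Torus.partialDeriv_mul (hW1 i k) (hW1 k j)]
    ring
  simp_rw [hprod, Finset.sum_add_distrib]
  rw [Finset.sum_comm, sum_vorticityTensor_mul_partialDeriv_eq hv j x]
  have h1 : ∑ k, ∑ i, Torus.partialDeriv i (torusVorticityTensor v i k) x * torusVorticityTensor v k j x =
      ∑ k, Torus.laplacian v x k * torusVorticityTensor v k j x := by
    refine Finset.sum_congr rfl fun k _ => ?_
    rw [← Finset.sum_mul, sum_partialDeriv_vorticityTensor_eq_laplacian hv hdiv k x]
  rw [h1]
  ring

/-- **Miller's orthogonality, tensor form, every dimension** (PAA 2026, Thm 1.3 = Thm 3.1,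
`⟨−ΔS, ω⊗ω⟩ = 0`; here `∫_{T^d} ∑ᵢⱼ (∂ᵢΔv)ⱼ (W²)ᵢⱼ = 0` for smooth divergence-free `v`, which on
`T³` is the printed statement by `ω⊗ω = W² + |ω|²I`, `tr ΔS = 0`, and the symmetry of `W²`).
Proof as printed: integrate `∂ᵢ` by parts onto `W²`, expand `∑ᵢ∂ᵢ(W²)ᵢⱼ = ∑ₖ(Δv)ₖWₖⱼ − ½∂ⱼ|ω|²`,
kill the first term pointwise by antisymmetry (`Δu ⊥ Δu × ω`) and the second by `div Δv = 0`.
[cite: Miller2026StrainVorticity, Thm 1.3 (= Thm 3.1)] -/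
theorem integral_sum_partialDeriv_laplacian_mul_vorticityTensor_sq_eq_zero
    {v : UnitAddTorus d → EuclideanSpace ℝ d} (hv : Torus.IsSmooth v) (hdiv : Torus.IsDivFree v) :
    ∫ x, ∑ i, ∑ j, Torus.partialDeriv i (Torus.laplacian v) x j *
        ∑ k, torusVorticityTensor v i k x * torusVorticityTensor v k j x = 0 := by
  have hL : Torus.IsSmooth (Torus.laplacian v) := hv.laplacian
  have hL1 : Torus.IsContDiff 1 (Torus.laplacian v) := hL.isContDiff (by simp)
  have hLc : ∀ j, Torus.IsSmooth (fun y => Torus.laplacian v y j) := fun j => hL.apply j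
  have hLc1 : ∀ j, Torus.IsContDiff 1 (fun y => Torus.laplacian v y j) := fun j =>
    (hLc j).isContDiff (by simp)
  have hW2 : ∀ i j, Torus.IsSmooth
      (fun y => ∑ k, torusVorticityTensor v i k y * torusVorticityTensor v k j y) :=
    fun i j => isSmooth_vorticityTensor_sq hv i j
  have hW21 : ∀ i j, Torus.IsContDiff 1
      (fun y => ∑ k, torusVorticityTensor v i k y * torusVorticityTensor v k j y) :=
    fun i j => (hW2 i j).isContDiff (by simp)
  have hQ : Torus.IsSmooth (torusVorticitySqAt v) := isSmooth_torusVorticitySqAt hv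
  -- the products `gᵢⱼ = (Δv)ⱼ (W²)ᵢⱼ`
  have hg : ∀ i j, Torus.IsSmooth (fun y => Torus.laplacian v y j *
      ∑ k, torusVorticityTensor v i k y * torusVorticityTensor v k j y) :=
    fun i j => (hLc j).mul (hW2 i j)
  -- pointwise: product rule and the divergence formula for `W²`
  have hpt : ∀ x, ∑ i, ∑ j, Torus.partialDeriv i (Torus.laplacian v) x j *
      ∑ k, torusVorticityTensor v i k x * torusVorticityTensor v k j x =
      (∑ i, ∑ j, Torus.partialDeriv i (fun y => Torus.laplacian v y j *
          ∑ k, torusVorticityTensor v i k y * torusVorticityTensor v k j y) x) +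
        2⁻¹ * Torus.fderiv (torusVorticitySqAt v) x (Torus.laplacian v x) := by
    intro x
    have hprod : ∀ i j, Torus.partialDeriv i (fun y => Torus.laplacian v y j *
        ∑ k, torusVorticityTensor v i k y * torusVorticityTensor v k j y) x =
        Torus.laplacian v x j * Torus.partialDeriv i
            (fun y => ∑ k, torusVorticityTensor v i k y * torusVorticityTensor v k j y) x +
          Torus.partialDeriv i (Torus.laplacian v) x j *
            ∑ k, torusVorticityTensor v i k x * torusVorticityTensor v k j x := by
      intro i j
      rw [Torus.partialDeriv_mul (hLc1 j) (hW21 i j), Torus.partialDeriv_apply_coord hL1]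
    simp_rw [hprod, Finset.sum_add_distrib]
    -- the correction term `∑ᵢⱼ (Δv)ⱼ ∂ᵢ(W²)ᵢⱼ = −½ ∑ⱼ (Δv)ⱼ ∂ⱼ|ω|²`
    have hcorr : ∑ i, ∑ j, Torus.laplacian v x j * Torus.partialDeriv i
        (fun y => ∑ k, torusVorticityTensor v i k y * torusVorticityTensor v k j y) x =
        -(2⁻¹ * Torus.fderiv (torusVorticitySqAt v) x (Torus.laplacian v x)) := by
      rw [Finset.sum_comm]
      simp_rw [← Finset.mul_sum, sum_partialDeriv_vorticityTensor_sq hv hdiv, mul_sub,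
        Finset.sum_sub_distrib]
      have h0 : ∑ j, Torus.laplacian v x j * ∑ k, Torus.laplacian v x k * torusVorticityTensor v k j x = 0 := by
        simp_rw [Finset.mul_sum, ← mul_assoc]
        exact sum_mul_mul_antisymm_eq_zero (fun j => Torus.laplacian v x j)
          (fun a b => torusVorticityTensor v a b x) (fun a b => torusVorticityTensor_swap v a b x)
      rw [h0, zero_sub, Torus.fderiv_apply_eq_sum_partialDeriv (hQ.isContDiff (by simp)),
        Finset.mul_sum]
      congr 1
      refine Finset.sum_congr rfl fun j _ => ?_
      rw [smul_eq_mul]; ring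
    rw [hcorr]; ring
  simp_rw [hpt]
  have hint1 : ∀ i j, Integrable (fun x => Torus.partialDeriv i (fun y => Torus.laplacian v y j *
      ∑ k, torusVorticityTensor v i k y * torusVorticityTensor v k j y) x) volume :=
    fun i j => ((hg i j).partialDeriv i).integrable
  have hint2 : Integrable (fun x => ∑ i, ∑ j, Torus.partialDeriv i (fun y => Torus.laplacian v y j *
      ∑ k, torusVorticityTensor v i k y * torusVorticityTensor v k j y) x) volume :=
    integrable_finsetSum _ fun i _ => integrable_finsetSum _ fun j _ => hint1 i j
  have hint3 : Integrable (fun x => 2⁻¹ * Torus.fderiv (torusVorticitySqAt v) x (Torus.laplacian v x))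
      volume := by
    have h := (Torus.integral_fderiv_apply_eq_zero_of_isDivFree hL hQ
      (Torus.IsDivFree.laplacian_of_isSmooth hv hdiv))
    -- integrability of the transport integrand: it is a finite sum of derivatives of smooth functions
    have h' : Integrable (fun x => Torus.fderiv (torusVorticitySqAt v) x (Torus.laplacian v x)) volume := by
      have hform : (fun x => Torus.fderiv (torusVorticitySqAt v) x (Torus.laplacian v x)) =
          fun x => ∑ i, Torus.partialDeriv i (fun y => Torus.laplacian v y i • torusVorticitySqAt v y) x :=
        funext fun x => Torus.fderiv_apply_eq_sum_partialDeriv_smul_of_isDivFree hL hQ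
          (Torus.IsDivFree.laplacian_of_isSmooth hv hdiv) x
      rw [hform]
      exact integrable_finsetSum _ fun i _ => (((hLc i).smul' hQ).partialDeriv i).integrable
    exact h'.const_mul _
  rw [integral_add hint2 hint3, integral_const_mul,
    Torus.integral_fderiv_apply_eq_zero_of_isDivFree hL hQ (Torus.IsDivFree.laplacian_of_isSmooth hv hdiv),
    mul_zero, add_zero, integral_finsetSum _ fun i _ => integrable_finsetSum _ fun j _ => hint1 i j]
  refine Finset.sum_eq_zero fun i _ => ?_
  rw [integral_finsetSum _ fun j _ => hint1 i j]
  exact Finset.sum_eq_zero fun j _ => Torus.integral_partialDeriv_eq_zero_holds (hg i j) i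


/-! ### The symmetrised (strain) form -/

/-- **`(ΔS)ᵢⱼ = ½((∂ᵢΔv)ⱼ + (∂ⱼΔv)ᵢ)`**: the Laplacian of the strain entry
`Sᵢⱼ = ½((∂ᵢv)ⱼ + (∂ⱼv)ᵢ)` of a smooth field is the strain entry of `Δv` (Schwarz) — the step
`S = ∇_{sym}u ⇒ −ΔS = ∇_{sym}(−Δu)` opening the printed proof ("`⟨−ΔS, ω⊗ω⟩ = ⟨∇(−Δu), ω⊗ω⟩`").
[cite: Miller2026StrainVorticity, §3, proof of Thm 3.1, first display] -/
theorem laplacian_strain_apply {v : UnitAddTorus d → EuclideanSpace ℝ d} (hv : Torus.IsSmooth v)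
    (i j : d) (x : UnitAddTorus d) :
    Torus.laplacian (fun y => (Torus.partialDeriv i v y j + Torus.partialDeriv j v y i) / 2) x =
      (Torus.partialDeriv i (Torus.laplacian v) x j + Torus.partialDeriv j (Torus.laplacian v) x i) / 2 := by
  have hi : Torus.IsSmooth (fun y => Torus.partialDeriv i v y j) := (hv.partialDeriv i).apply j
  have hj : Torus.IsSmooth (fun y => Torus.partialDeriv j v y i) := (hv.partialDeriv j).apply i
  have hfun : (fun y => (Torus.partialDeriv i v y j + Torus.partialDeriv j v y i) / 2) =
      (2⁻¹ : ℝ) • ((fun y => Torus.partialDeriv i v y j) + fun y => Torus.partialDeriv j v y i) := by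
    funext y; simp [div_eq_inv_mul]
  have hcoord : ∀ a b, Torus.laplacian (fun y => Torus.partialDeriv a v y b) x =
      Torus.partialDeriv a (Torus.laplacian v) x b := by
    intro a b
    rw [Torus.partialDeriv_laplacian_comm hv a x]
    have := Torus.laplacian_clm_comp_apply (hv.partialDeriv a)
      (EuclideanSpace.proj b : EuclideanSpace ℝ d →L[ℝ] ℝ) x
    simpa [Function.comp_def] using this
  rw [hfun, Torus.laplacian_const_smul_apply (hi.add hj), Torus.laplacian_add_apply hi hj, hcoord i j,
    hcoord j i, smul_eq_mul]
  ring

/-- **Miller's orthogonality with the symmetrised factor `ΔS`** (PAA 2026, Thm 1.3): for smooth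
divergence-free `v` on `T^d`, `∫ ∑ᵢⱼ (ΔS)ᵢⱼ (W²)ᵢⱼ = 0`, `(ΔS)ᵢⱼ = ½((∂ᵢΔv)ⱼ + (∂ⱼΔv)ᵢ)`
(`= Δ` of the strain entry, `laplacian_strain_apply`), `(W²)ᵢⱼ = ∑ₖWᵢₖWₖⱼ` (symmetric, so the
symmetrisation is immaterial). [cite: Miller2026StrainVorticity, Thm 1.3 (= Thm 3.1)] -/
theorem integral_sum_laplacian_strain_mul_vorticityTensor_sq_eq_zero
    {v : UnitAddTorus d → EuclideanSpace ℝ d} (hv : Torus.IsSmooth v) (hdiv : Torus.IsDivFree v) :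
    ∫ x, ∑ i, ∑ j,
        ((Torus.partialDeriv i (Torus.laplacian v) x j + Torus.partialDeriv j (Torus.laplacian v) x i) / 2) *
          ∑ k, torusVorticityTensor v i k x * torusVorticityTensor v k j x = 0 := by
  have hpt : ∀ x, ∑ i, ∑ j,
      ((Torus.partialDeriv i (Torus.laplacian v) x j + Torus.partialDeriv j (Torus.laplacian v) x i) / 2) *
        ∑ k, torusVorticityTensor v i k x * torusVorticityTensor v k j x =
      ∑ i, ∑ j, Torus.partialDeriv i (Torus.laplacian v) x j *
        ∑ k, torusVorticityTensor v i k x * torusVorticityTensor v k j x := by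
    intro x
    have hswap : ∑ i, ∑ j, Torus.partialDeriv j (Torus.laplacian v) x i *
        ∑ k, torusVorticityTensor v i k x * torusVorticityTensor v k j x =
        ∑ i, ∑ j, Torus.partialDeriv i (Torus.laplacian v) x j *
          ∑ k, torusVorticityTensor v i k x * torusVorticityTensor v k j x := by
      rw [Finset.sum_comm]
      refine Finset.sum_congr rfl fun i _ => Finset.sum_congr rfl fun j _ => ?_
      rw [sum_vorticityTensor_mul_comm v i j x]
    have hsplit : ∑ i, ∑ j,
        ((Torus.partialDeriv i (Torus.laplacian v) x j + Torus.partialDeriv j (Torus.laplacian v) x i) / 2) *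
          ∑ k, torusVorticityTensor v i k x * torusVorticityTensor v k j x =
        2⁻¹ * (∑ i, ∑ j, Torus.partialDeriv i (Torus.laplacian v) x j *
            ∑ k, torusVorticityTensor v i k x * torusVorticityTensor v k j x) +
          2⁻¹ * (∑ i, ∑ j, Torus.partialDeriv j (Torus.laplacian v) x i *
            ∑ k, torusVorticityTensor v i k x * torusVorticityTensor v k j x) := by
      rw [Finset.mul_sum, Finset.mul_sum, ← Finset.sum_add_distrib]
      refine Finset.sum_congr rfl fun i _ => ?_
      rw [Finset.mul_sum, Finset.mul_sum, ← Finset.sum_add_distrib]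
      refine Finset.sum_congr rfl fun j _ => ?_
      ring
    rw [hsplit, hswap]; ring
  simp_rw [hpt]
  exact integral_sum_partialDeriv_laplacian_mul_vorticityTensor_sq_eq_zero hv hdiv

/-! ### `card d = 3`: the printed form `⟨−ΔS, ω ⊗ ω⟩ = 0` -/

/-- Polynomial identity behind `ω ⊗ ω = W² + |ω|² I` on `Fin 3`: for `3 × 3` arrays `P`
(`Pₐᵦ = (∂ₐv)ᵦ`), `M`, and `w = (W₁₂, W₂₀, W₀₁)`, `W = P − Pᵀ`:
`∑ₐᵦ wₐ Mₐᵦ w_b = ∑ₐᵦ Mₐᵦ (W²)ₐᵦ + (tr M) · ½∑ᵢⱼWᵢⱼ²`. [folklore] -/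
private theorem sum_mul_mul_eq_sum_mul_sq_add_trace (P M : Fin 3 → Fin 3 → ℝ) (w : Fin 3 → ℝ)
    (hw : w = ![P 1 2 - P 2 1, P 2 0 - P 0 2, P 0 1 - P 1 0]) :
    ∑ a, ∑ b, w a * M a b * w b =
      (∑ a, ∑ b, M a b * ∑ k, (P a k - P k a) * (P k b - P b k)) +
        (∑ a, M a a) * (2⁻¹ * ∑ i, ∑ j, (P i j - P j i) ^ 2) := by
  subst hw
  simp only [Fin.sum_univ_three, Matrix.cons_val_zero, Matrix.cons_val_one, Matrix.head_cons,
    Matrix.cons_val_two, Matrix.tail_cons]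
  ring

/-- **`ωᵀ M ω = tr(M W²) + (tr M)|ω|²` pointwise on `T³`, any labelling** `e : d ≃ Fin 3`
(`ωₐ := W_{e⁻¹(e a+1), e⁻¹(e a+2)}`, the curl read in the frame `e`; Majda–Bertozzi 2002, (1.21)),
for an arbitrary `d × d` array `M`: the matrix identity `ω ⊗ ω = W² + |ω|² I`, i.e. `4Ω² = ω⊗ω − |ω|²I`
for the rotation matrix `Ω = −½W`, which is (1.21) `Ωh = ½ ω × h` of Majda–Bertozzi 2002, §1.4,
applied twice (`Ω²h = ¼ ω × (ω × h) = ¼(ω(ω·h) − |ω|²h)`). [cite: MajdaBertozziCUP2002, §1.4 eq. (1.21)] -/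
theorem sum_vorticity_mul_mul_vorticity_eq (e : d ≃ Fin 3) (v : UnitAddTorus d → EuclideanSpace ℝ d)
    (M : d → d → ℝ) (x : UnitAddTorus d) :
    ∑ a, ∑ b, torusVorticityTensor v (e.symm (e a + 1)) (e.symm (e a + 2)) x * M a b *
        torusVorticityTensor v (e.symm (e b + 1)) (e.symm (e b + 2)) x =
      (∑ a, ∑ b, M a b * ∑ k, torusVorticityTensor v a k x * torusVorticityTensor v k b x) +
        (∑ a, M a a) * torusVorticitySqAt v x := by
  set P : Fin 3 → Fin 3 → ℝ := fun a b => Torus.partialDeriv (e.symm a) v x (e.symm b) with hP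
  set M' : Fin 3 → Fin 3 → ℝ := fun a b => M (e.symm a) (e.symm b) with hM'
  set w : Fin 3 → ℝ := ![P 1 2 - P 2 1, P 2 0 - P 0 2, P 0 1 - P 1 0] with hw
  have hre : ∀ G : d → ℝ, ∑ i, G i = ∑ a : Fin 3, G (e.symm a) := fun G =>
    Fintype.sum_equiv e _ _ fun i => by simp
  have hwa : ∀ a : Fin 3,
      torusVorticityTensor v (e.symm (e (e.symm a) + 1)) (e.symm (e (e.symm a) + 2)) x = w a := by
    intro a
    rw [e.apply_symm_apply]
    fin_cases a <;> simp [hw, hP, torusVorticityTensor]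
  have h1 := sum_mul_mul_eq_sum_mul_sq_add_trace P M' w hw
  rw [torusVorticitySqAt]
  simp only [torusVorticityTensor] at hwa ⊢
  simp_rw [hre]
  simp only [hwa] at *
  simpa [hP, hM'] using h1

/-- **Miller's Theorem 1.3 on `T³`, as printed: `⟨−ΔS, ω ⊗ ω⟩ = 0`** (PAA 2026, Thm 1.3 = Thm 3.1:
"Suppose `S ∈ H²_{st}`, with `S = ∇_{sym}u` and `ω = ∇ × u`. Then `⟨−ΔS, ω⊗ω⟩ = 0`"). For a smooth
divergence-free field `v` on `T^d`, `card d = 3`, any labelling `e : d ≃ Fin 3`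
(`ωₐ := W_{e⁻¹(e a+1), e⁻¹(e a+2)}`), with `(ΔS)ₐᵦ = ½((∂ₐΔv)ᵦ + (∂ᵦΔv)ₐ)`:
`∫ ∑ₐᵦ ωₐ (ΔS)ₐᵦ ω_b = 0`. From the tensor form via `ω⊗ω = W² + |ω|²I` and
`tr ΔS = div Δv = 0`. [cite: Miller2026StrainVorticity, Thm 1.3 (= Thm 3.1)] -/
theorem integral_sum_vorticity_laplacianStrain_vorticity_eq_zero (e : d ≃ Fin 3)
    {v : UnitAddTorus d → EuclideanSpace ℝ d} (hv : Torus.IsSmooth v) (hdiv : Torus.IsDivFree v) :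
    ∫ x, ∑ a, ∑ b, torusVorticityTensor v (e.symm (e a + 1)) (e.symm (e a + 2)) x *
        ((Torus.partialDeriv a (Torus.laplacian v) x b + Torus.partialDeriv b (Torus.laplacian v) x a) / 2) *
        torusVorticityTensor v (e.symm (e b + 1)) (e.symm (e b + 2)) x = 0 := by
  have hL1 : Torus.IsContDiff 1 (Torus.laplacian v) := hv.laplacian.isContDiff (by simp)
  have hdivL : Torus.IsDivFree (Torus.laplacian v) := Torus.IsDivFree.laplacian_of_isSmooth hv hdiv
  have hpt : ∀ x, ∑ a, ∑ b, torusVorticityTensor v (e.symm (e a + 1)) (e.symm (e a + 2)) x *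
        ((Torus.partialDeriv a (Torus.laplacian v) x b + Torus.partialDeriv b (Torus.laplacian v) x a) / 2) *
        torusVorticityTensor v (e.symm (e b + 1)) (e.symm (e b + 2)) x =
      ∑ a, ∑ b,
        ((Torus.partialDeriv a (Torus.laplacian v) x b + Torus.partialDeriv b (Torus.laplacian v) x a) / 2) *
          ∑ k, torusVorticityTensor v a k x * torusVorticityTensor v k b x := by
    intro x
    rw [sum_vorticity_mul_mul_vorticity_eq e v _ x]
    have htr : ∑ a, (Torus.partialDeriv a (Torus.laplacian v) x a +
        Torus.partialDeriv a (Torus.laplacian v) x a) / 2 = 0 := by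
      have h1 : ∑ a, (Torus.partialDeriv a (Torus.laplacian v) x a +
          Torus.partialDeriv a (Torus.laplacian v) x a) / 2 = ∑ a, Torus.partialDeriv a (Torus.laplacian v) x a :=
        Finset.sum_congr rfl fun a _ => by ring
      rw [h1, ← Torus.divergence_eq_sum_partialDeriv_apply hL1 x]
      exact hdivL x
    rw [htr, zero_mul, add_zero]
  simp_rw [hpt]
  exact integral_sum_laplacian_strain_mul_vorticityTensor_sq_eq_zero hv hdiv

/-! ### The stretching integral is the inertial term of the enstrophy balance -/

omit [DecidableEq d] in
/-- Pointwise, in every dimension: `σ = tr(∇v)³ − tr(∇v (∇v)ᵀ (∇v)ᵀ)` for the stretching density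
`σ = −∑ᵢⱼ Wᵢⱼ ∑ₖ (∂ᵢv)ₖ(∂ₖv)ⱼ` (`W = P − Pᵀ`, `Pᵢₖ = (∂ᵢv)ₖ`: expand and relabel). [folklore] -/
private theorem neg_sum_antisymm_mul_sq_eq_cube_sub (P : d → d → ℝ) :
    -(∑ i, ∑ j, (P i j - P j i) * ∑ k, P i k * P k j) =
      (∑ i, ∑ j, ∑ k, P j i * P k j * P i k) - ∑ m, ∑ i, P m i * ∑ j, P m j * P i j := by
  have e1 : -(∑ i, ∑ j, (P i j - P j i) * ∑ k, P i k * P k j) =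
      ∑ i, ∑ j, ∑ k, (P j i * P k j * P i k - P i j * P i k * P k j) := by
    rw [← Finset.sum_neg_distrib]
    refine Finset.sum_congr rfl fun i _ => ?_
    rw [← Finset.sum_neg_distrib]
    refine Finset.sum_congr rfl fun j _ => ?_
    rw [Finset.mul_sum, ← Finset.sum_neg_distrib]
    refine Finset.sum_congr rfl fun k _ => ?_
    ring
  have e2 : ∀ m, ∑ i, P m i * ∑ j, P m j * P i j = ∑ a, ∑ b, P m a * P m b * P b a := by
    intro m
    simp_rw [Finset.mul_sum]
    rw [Finset.sum_comm]
    refine Finset.sum_congr rfl fun a _ => Finset.sum_congr rfl fun b _ => ?_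
    ring
  rw [e1]
  simp_rw [e2, Finset.sum_sub_distrib]

/-- **`∫ ⟪(v·∇)v, Δv⟫ = ∫ σ`** for smooth divergence-free `v` on `T^d`: the inertial term of the
enstrophy balance `dℰ/dt = −ν‖Δu‖₂² + ∫⟪(u·∇)u, Δu⟫` is the vortex-stretching integral
(`σ = torusStretchingDensity = tr(S W²)`, `= ωᵀSω` on `T³`), i.e. Miller's
`d/dt ½‖ω‖²₂ = −‖ω‖²_{Ḣ¹} + ⟨S, ω⊗ω⟩` (PAA 2026, (6.3)). Proof: pointwise
`σ = tr(∇v)³ − tr(∇v∇vᵀ∇vᵀ)`, Betchov's `∫tr(∇v)³ = 0` and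
`∫⟪Δv, (v·∇)v⟫ = −∫tr(∇v∇vᵀ∇vᵀ)`. [cite: Miller2026StrainVorticity, §6, eq. (6.3)] -/
theorem integral_inner_convect_laplacian_eq_integral_torusStretchingDensity
    {v : UnitAddTorus d → EuclideanSpace ℝ d} (hv : Torus.IsSmooth v) (hdiv : Torus.IsDivFree v) :
    ∫ x, ⟪Torus.convect v v x, Torus.laplacian v x⟫_ℝ = ∫ x, torusStretchingDensity v x := by
  have hD : ∀ m, Torus.IsSmooth (Torus.partialDeriv m v) := fun m => hv.partialDeriv m
  have hDc : ∀ m j, Torus.IsSmooth (fun y => Torus.partialDeriv m v y j) := fun m j => (hD m).apply j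
  have h1 : ∫ x, ⟪Torus.convect v v x, Torus.laplacian v x⟫_ℝ =
      ∫ x, ⟪Torus.laplacian v x, Torus.convect v v x⟫_ℝ :=
    integral_congr_ae (Filter.Eventually.of_forall fun x => real_inner_comm _ _)
  rw [h1, Torus.integral_inner_laplacian_convect_self_eq_neg hv hdiv]
  -- pointwise `σ = B − C`
  have hinner : ∀ x m i, Torus.partialDeriv m v x i *
      ⟪Torus.partialDeriv m v x, Torus.partialDeriv i v x⟫_ℝ =
      Torus.partialDeriv m v x i * ∑ j, Torus.partialDeriv m v x j * Torus.partialDeriv i v x j := by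
    intro x m i
    rw [show ⟪Torus.partialDeriv m v x, Torus.partialDeriv i v x⟫_ℝ =
      ∑ j, Torus.partialDeriv m v x j * Torus.partialDeriv i v x j from by
        simp [PiLp.inner_apply, mul_comm]]
  have hσ : ∀ x, torusStretchingDensity v x =
      (∑ i, ∑ j, ∑ k, Torus.partialDeriv j v x i * Torus.partialDeriv k v x j *
          Torus.partialDeriv i v x k) -
        ∑ m, ∑ i, Torus.partialDeriv m v x i *
          ⟪Torus.partialDeriv m v x, Torus.partialDeriv i v x⟫_ℝ := by
    intro x
    simp_rw [hinner]
    rw [torusStretchingDensity]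
    simp only [torusVorticityTensor]
    exact neg_sum_antisymm_mul_sq_eq_cube_sub (fun a b => Torus.partialDeriv a v x b)
  -- smoothness, hence integrability, of `B` and `C`
  have hB : Torus.IsSmooth (fun x => ∑ i, ∑ j, ∑ k, Torus.partialDeriv j v x i *
      Torus.partialDeriv k v x j * Torus.partialDeriv i v x k) := by
    have h : ∀ i j k, Torus.IsSmooth (fun x => Torus.partialDeriv j v x i *
        Torus.partialDeriv k v x j * Torus.partialDeriv i v x k) :=
      fun i j k => ((hDc j i).mul (hDc k j)).mul (hDc i k)
    unfold Torus.IsSmooth at h ⊢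
    exact ContDiff.sum fun i _ => ContDiff.sum fun j _ => ContDiff.sum fun k _ => h i j k
  have hC : Torus.IsSmooth (fun x => ∑ m, ∑ i, Torus.partialDeriv m v x i *
      ⟪Torus.partialDeriv m v x, Torus.partialDeriv i v x⟫_ℝ) := by
    have h : ∀ m i, Torus.IsSmooth (fun x => Torus.partialDeriv m v x i *
        ⟪Torus.partialDeriv m v x, Torus.partialDeriv i v x⟫_ℝ) :=
      fun m i => (hDc m i).mul ((hD m).inner (hD i))
    unfold Torus.IsSmooth at h ⊢
    exact ContDiff.sum fun m _ => ContDiff.sum fun i _ => h m i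
  simp_rw [hσ]
  rw [integral_sub hB.integrable hC.integrable, integral_sum_partialDeriv_cube_eq_zero hv hdiv, zero_sub]

/-- **The stretching integral with a shifted strain, `T³`** (Miller, PAA 2026, (6.5): "for all
`0 < t < T_max` and for all `ρ ∈ ℝ`, `d/dt ½‖ω‖²₂ = −‖ω‖²_{Ḣ¹} − ⟨−ρΔS − S, ω⊗ω⟩`" — the
`ρΔS` term is free by Theorem 1.3). For smooth divergence-free `v` on `T^d`, `card d = 3`, any
labelling `e`, and every `ρ : ℝ`:
`∫ σ = ∫ ∑ₐᵦ ωₐ (Sₐᵦ + ρ (ΔS)ₐᵦ) ω_b`, `Sₐᵦ = ½((∂ᵦv)ₐ + (∂ₐv)ᵦ)`,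
`(ΔS)ₐᵦ = ½((∂ₐΔv)ᵦ + (∂ᵦΔv)ₐ)`. [cite: Miller2026StrainVorticity, §6, eq. (6.5)] -/
theorem integral_torusStretchingDensity_eq_integral_shifted (e : d ≃ Fin 3)
    {v : UnitAddTorus d → EuclideanSpace ℝ d} (hv : Torus.IsSmooth v) (hdiv : Torus.IsDivFree v)
    (ρ : ℝ) :
    ∫ x, torusStretchingDensity v x =
      ∫ x, ∑ a, ∑ b, torusVorticityTensor v (e.symm (e a + 1)) (e.symm (e a + 2)) x *
        ((Torus.partialDeriv b v x a + Torus.partialDeriv a v x b) / 2 +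
          ρ * ((Torus.partialDeriv a (Torus.laplacian v) x b +
            Torus.partialDeriv b (Torus.laplacian v) x a) / 2)) *
        torusVorticityTensor v (e.symm (e b + 1)) (e.symm (e b + 2)) x := by
  have hv1 : Torus.IsContDiff 1 v := hv.isContDiff (by simp)
  have hW : ∀ a b, Torus.IsSmooth (torusVorticityTensor v a b) := fun a b => isSmooth_vorticityTensor hv a b
  have hD : ∀ a b, Torus.IsSmooth (fun y => Torus.partialDeriv a v y b) := fun a b => (hv.partialDeriv a).apply b
  have hDL : ∀ a b, Torus.IsSmooth (fun y => Torus.partialDeriv a (Torus.laplacian v) y b) :=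
    fun a b => (hv.laplacian.partialDeriv a).apply b
  -- the two summands, as smooth functions
  set F : UnitAddTorus d → ℝ := fun x => ∑ a, ∑ b,
    torusVorticityTensor v (e.symm (e a + 1)) (e.symm (e a + 2)) x *
      ((Torus.partialDeriv b v x a + Torus.partialDeriv a v x b) / 2) *
      torusVorticityTensor v (e.symm (e b + 1)) (e.symm (e b + 2)) x with hF
  set G : UnitAddTorus d → ℝ := fun x => ∑ a, ∑ b,
    torusVorticityTensor v (e.symm (e a + 1)) (e.symm (e a + 2)) x *
      ((Torus.partialDeriv a (Torus.laplacian v) x b + Torus.partialDeriv b (Torus.laplacian v) x a) / 2) *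
      torusVorticityTensor v (e.symm (e b + 1)) (e.symm (e b + 2)) x with hG
  have hFs : Torus.IsSmooth F := by
    have h : ∀ a b, Torus.IsSmooth (fun x => torusVorticityTensor v (e.symm (e a + 1)) (e.symm (e a + 2)) x *
        ((Torus.partialDeriv b v x a + Torus.partialDeriv a v x b) / 2) *
        torusVorticityTensor v (e.symm (e b + 1)) (e.symm (e b + 2)) x) := fun a b =>
      ((hW _ _).mul (((hD b a).add (hD a b)).div_const 2)).mul (hW _ _)
    unfold Torus.IsSmooth at h ⊢
    simp only [hF]
    exact ContDiff.sum fun a _ => ContDiff.sum fun b _ => h a b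
  have hGs : Torus.IsSmooth G := by
    have h : ∀ a b, Torus.IsSmooth (fun x => torusVorticityTensor v (e.symm (e a + 1)) (e.symm (e a + 2)) x *
        ((Torus.partialDeriv a (Torus.laplacian v) x b + Torus.partialDeriv b (Torus.laplacian v) x a) / 2) *
        torusVorticityTensor v (e.symm (e b + 1)) (e.symm (e b + 2)) x) := fun a b =>
      ((hW _ _).mul (((hDL a b).add (hDL b a)).div_const 2)).mul (hW _ _)
    unfold Torus.IsSmooth at h ⊢
    simp only [hG]
    exact ContDiff.sum fun a _ => ContDiff.sum fun b _ => h a b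
  have hsplit : ∀ x, ∑ a, ∑ b, torusVorticityTensor v (e.symm (e a + 1)) (e.symm (e a + 2)) x *
        ((Torus.partialDeriv b v x a + Torus.partialDeriv a v x b) / 2 +
          ρ * ((Torus.partialDeriv a (Torus.laplacian v) x b +
            Torus.partialDeriv b (Torus.laplacian v) x a) / 2)) *
        torusVorticityTensor v (e.symm (e b + 1)) (e.symm (e b + 2)) x = F x + ρ * G x := by
    intro x
    simp only [hF, hG, Finset.mul_sum, ← Finset.sum_add_distrib]
    refine Finset.sum_congr rfl fun a _ => Finset.sum_congr rfl fun b _ => ?_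
    ring
  simp_rw [hsplit]
  rw [integral_add hFs.integrable (hGs.integrable.const_mul ρ), integral_const_mul]
  have hG0 : ∫ x, G x = 0 := integral_sum_vorticity_laplacianStrain_vorticity_eq_zero e hv hdiv
  have hF1 : ∫ x, torusStretchingDensity v x = ∫ x, F x :=
    integral_congr_ae (Filter.Eventually.of_forall fun x =>
      torusStretchingDensity_eq_sum_strain_of_equiv_of_isDivFree e hv1 hdiv x)
  rw [hG0, mul_zero, add_zero, hF1]

/-- **The inertial term of the enstrophy balance with a shifted strain, `T³`**: for smooth
divergence-free `v` (`card d = 3`, any labelling `e`) and every `ρ : ℝ`,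
`∫ ⟪(v·∇)v, Δv⟫ = ∫ ∑ₐᵦ ωₐ (Sₐᵦ + ρ(ΔS)ₐᵦ) ω_b` — Miller's (6.5) read on the tree's enstrophy
balance `dℰ/dt = −ν‖Δu‖₂² + ∫⟪(u·∇)u, Δu⟫` (`Torus.IsClassicalNSSolutionOn.hasDerivWithinAt_half_gradNormSq`).
[cite: Miller2026StrainVorticity, §6, eq. (6.5)] -/
theorem integral_inner_convect_laplacian_eq_integral_shifted (e : d ≃ Fin 3)
    {v : UnitAddTorus d → EuclideanSpace ℝ d} (hv : Torus.IsSmooth v) (hdiv : Torus.IsDivFree v)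
    (ρ : ℝ) :
    ∫ x, ⟪Torus.convect v v x, Torus.laplacian v x⟫_ℝ =
      ∫ x, ∑ a, ∑ b, torusVorticityTensor v (e.symm (e a + 1)) (e.symm (e a + 2)) x *
        ((Torus.partialDeriv b v x a + Torus.partialDeriv a v x b) / 2 +
          ρ * ((Torus.partialDeriv a (Torus.laplacian v) x b +
            Torus.partialDeriv b (Torus.laplacian v) x a) / 2)) *
        torusVorticityTensor v (e.symm (e b + 1)) (e.symm (e b + 2)) x := by
  rw [integral_inner_convect_laplacian_eq_integral_torusStretchingDensity hv hdiv,
    integral_torusStretchingDensity_eq_integral_shifted e hv hdiv ρ]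

end StrainVorticityOrthogonality

end Literature.Analysis.FluidPDE
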